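import Mathlib
import HarnessLib
import Literature.Probability.Percolation.MinOpenCut
import Literature.Probability.Percolation.SharpnessDCTProofs
import Literature.Probability.Percolation.SitePaths

/-!
# `stub_thickMono` of line `Sketch` (crux `BudgetTightness`, stmt-CriticalPhenomena-5248):
# the bottom-to-top min-cut of a slab piece is antitone in the thickness

Registered stub `stub_thickMono` of the lead's skeleton `Cruxes/BudgetTightness/Lines/Sketch.lean`.

Let `Q(L,h) = [0,L]² × [0,h] = Set.Icc ![0,0,0] ![L,L,h] ⊆ ℤ³` be a slab piece with bottom layer
`{x₂ = 0} = Set.Icc ![0,0,0] ![L,L,0]` and top layer `{x₂ = h} = Set.Icc ![0,0,h] ![L,L,h]`, and let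
`S(L,h)(ω) = minOpenCutIn Q(L,h) bottom top_h ω` be its bottom-to-top min-cut budget
(`Literature/Probability/Percolation/MinOpenCut.lean`). For a LATTICE configuration
`ω ⊆ E(ℤ³)` we prove `S(L,h+1)(ω) ≤ S(L,h)(ω)`.

Proof. Every open cutset `T` of the thin piece `(Q(L,h), bottom, top_h)` is an open cutset of the
thick piece `(Q(L,h+1), bottom, top_{h+1})` (`StubThickMono.isOpenCutsetIn_thick`): an open
bottom-to-top path of the thick piece avoiding `T` starts in `{x₂ ≤ h}` and ends outside it, so it
has a first exit edge `a ∼ b` (`PathIn.exit`, `SitePaths.lean`) with `a₂ ≤ h < b₂`; the edge is a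
lattice edge (`ω ⊆ E(ℤ³)`, `DCT16.adj_of_openGraph_adj`), so `|a₂ - b₂| ≤ 1` forces `a₂ = h`,
i.e. `a ∈ top_h`, and the initial segment up to `a` is an open path of `Q(L,h) ⊇ {x₂ ≤ h} ∩ Q(L,h+1)`
from the bottom to `top_h` avoiding `T` — contradicting that `T` cuts the thin piece. Then
`minOpenCutIn` (an infimum over finite open cutsets) is monotone under this inclusion of cutset
families (`le_iInf₂` / `minOpenCutIn_le_card`).
-/

noncomputable section

namespace Summit.CriticalPhenomena.PercolationContinuityZ3.Theorems.BudgetTightness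

open MeasureTheory ProbabilityTheory
open Literature.Probability.Percolation Literature.Probability.LatticeModels

namespace StubThickMono

/-- Membership in a coordinate box `Set.Icc ![a0,a1,a2] ![b0,b1,b2]` of `ℤ³`, coordinatewise. -/
theorem mem_Icc_vec3_iff {v : Site 3} {a0 a1 a2 b0 b1 b2 : ℤ} :
    v ∈ Set.Icc (![a0, a1, a2] : Site 3) ![b0, b1, b2] ↔
      (a0 ≤ v 0 ∧ a1 ≤ v 1 ∧ a2 ≤ v 2) ∧ (v 0 ≤ b0 ∧ v 1 ≤ b1 ∧ v 2 ≤ b2) := by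
  simp only [Set.mem_Icc, Pi.le_def, Fin.forall_fin_succ, IsEmpty.forall_iff, and_true,
    Matrix.cons_val_zero, Matrix.cons_val_succ, Fin.succ_zero_eq_one, Fin.succ_one_eq_two]

/-- The lower part `{x₂ ≤ h}` of the thick piece `Q(L,h+1)` lies in the thin piece `Q(L,h)`. -/
theorem setOf_le_inter_thick_subset_thin (L h : ℕ) :
    {v : Site 3 | v 2 ≤ (h : ℤ)} ∩ Set.Icc (![0, 0, 0] : Site 3) ![(L : ℤ), (L : ℤ), ((h + 1 : ℕ) : ℤ)]
      ⊆ Set.Icc (![0, 0, 0] : Site 3) ![(L : ℤ), (L : ℤ), (h : ℤ)] := by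
  rintro v ⟨hv2, hv⟩
  rw [Set.mem_setOf_eq] at hv2
  rw [mem_Icc_vec3_iff] at hv ⊢
  exact ⟨hv.1, hv.2.1, hv.2.2.1, hv2⟩

/-- **Cutset transfer.** On a lattice configuration `ω ⊆ E(ℤ³)`, an open cutset of the thin piece
`(Q(L,h), bottom, top_h)` is an open cutset of the thick piece `(Q(L,h+1), bottom, top_{h+1})`:
an open bottom-to-top path of the thick piece first exits `{x₂ ≤ h}` along a lattice edge from the
layer `{x₂ = h}`, and its initial segment is an open bottom-to-`top_h` path of the thin piece. -/
theorem isOpenCutsetIn_thick {L h : ℕ} {ω : BondConfig (Site 3)} (hω : ω ⊆ (zdGraph 3).edgeSet)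
    {T : Set (Sym2 (Site 3))}
    (hT : IsOpenCutsetIn (Set.Icc (![0, 0, 0] : Site 3) ![(L : ℤ), (L : ℤ), (h : ℤ)])
      (Set.Icc (![0, 0, 0] : Site 3) ![(L : ℤ), (L : ℤ), 0])
      (Set.Icc (![0, 0, (h : ℤ)] : Site 3) ![(L : ℤ), (L : ℤ), (h : ℤ)]) ω T) :
    IsOpenCutsetIn (Set.Icc (![0, 0, 0] : Site 3) ![(L : ℤ), (L : ℤ), ((h + 1 : ℕ) : ℤ)])
      (Set.Icc (![0, 0, 0] : Site 3) ![(L : ℤ), (L : ℤ), 0])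
      (Set.Icc (![0, 0, ((h + 1 : ℕ) : ℤ)] : Site 3) ![(L : ℤ), (L : ℤ), ((h + 1 : ℕ) : ℤ)])
      ω T := by
  intro x hx y hy hconn
  have hp : PathIn (openGraph (ω \ T))
      (Set.Icc (![0, 0, 0] : Site 3) ![(L : ℤ), (L : ℤ), ((h + 1 : ℕ) : ℤ)]) x y :=
    DCT16.pathIn_of_mem_openConnIn hconn
  have hxR : x ∈ {v : Site 3 | v 2 ≤ (h : ℤ)} := by
    rw [mem_Icc_vec3_iff] at hx
    rw [Set.mem_setOf_eq]
    exact hx.2.2.2.trans (Nat.cast_nonneg h)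
  have hyR : y ∉ {v : Site 3 | v 2 ≤ (h : ℤ)} := by
    rw [mem_Icc_vec3_iff] at hy
    rw [Set.mem_setOf_eq]
    have hy2 := hy.1.2.2
    push_cast at hy2
    omega
  obtain ⟨a, b, haR, hbR, -, hab, hpa⟩ := hp.exit hxR hyR
  rw [Set.mem_setOf_eq] at haR hbR
  -- the exit edge is a lattice edge, so the third coordinates differ by at most one
  have hadj : (zdGraph 3).Adj a b := DCT16.adj_of_openGraph_adj (Set.sdiff_subset.trans hω) hab
  have h1 : |a 2 - b 2| ≤ 1 := DCT16.abs_sub_le_one_of_adj hadj 2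
  rw [abs_le] at h1
  have ha2 : a 2 = (h : ℤ) := by omega
  -- `a` lies in the thick piece (endpoint of the initial segment), hence on the layer `x₂ = h`
  have haQ := (hpa.right_mem).2
  rw [mem_Icc_vec3_iff] at haQ
  have ha_top : a ∈ Set.Icc (![0, 0, (h : ℤ)] : Site 3) ![(L : ℤ), (L : ℤ), (h : ℤ)] := by
    rw [mem_Icc_vec3_iff]
    exact ⟨⟨haQ.1.1, haQ.1.2.1, ha2.ge⟩, ⟨haQ.2.1, haQ.2.2.1, ha2.le⟩⟩
  -- the initial segment is an open path of the thin piece avoiding `T`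
  have hconn' : ω \ T ∈ openConnIn (Set.Icc (![0, 0, 0] : Site 3) ![(L : ℤ), (L : ℤ), (h : ℤ)]) x a :=
    DCT16.mem_openConnIn_of_pathIn (hpa.mono (setOf_le_inter_thick_subset_thin L h))
  exact hT x hx a ha_top hconn'

end StubThickMono

/-- **stub_thickMono** (antitone in the thickness, pointwise on lattice configurations): for
`ω ⊆ E(ℤ³)`, `S(L, h+1)(ω) ≤ S(L, h)(ω)` — every finite open cutset of the thin piece
`(Q(L,h), bottom, top_h)` is an open cutset of the thick piece `(Q(L,h+1), bottom, top_{h+1})`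
(`StubThickMono.isOpenCutsetIn_thick`), and `minOpenCutIn` is the least cardinality of a finite
open cutset. (For `h = 0` the right-hand side is `⊤`; a non-lattice pair could jump layers, whence
the hypothesis `ω ⊆ E(ℤ³)`.) -/
theorem stub_thickMono :
    ∀ (L h : ℕ) (ω : BondConfig (Site 3)), ω ⊆ (zdGraph 3).edgeSet →
      minOpenCutIn
          (Set.Icc (![0, 0, 0] : Site 3) ![(L : ℤ), (L : ℤ), ((h + 1 : ℕ) : ℤ)])
          (Set.Icc (![0, 0, 0] : Site 3) ![(L : ℤ), (L : ℤ), 0])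
          (Set.Icc (![0, 0, ((h + 1 : ℕ) : ℤ)] : Site 3) ![(L : ℤ), (L : ℤ), ((h + 1 : ℕ) : ℤ)]) ω ≤
      minOpenCutIn
          (Set.Icc (![0, 0, 0] : Site 3) ![(L : ℤ), (L : ℤ), (h : ℤ)])
          (Set.Icc (![0, 0, 0] : Site 3) ![(L : ℤ), (L : ℤ), 0])
          (Set.Icc (![0, 0, (h : ℤ)] : Site 3) ![(L : ℤ), (L : ℤ), (h : ℤ)]) ω := by
  intro L h ω hω
  exact le_iInf₂ fun T hT => minOpenCutIn_le_card (StubThickMono.isOpenCutsetIn_thick hω hT)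

end Summit.CriticalPhenomena.PercolationContinuityZ3.Theorems.BudgetTightness

end
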